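import Summits.Ventures.LatticeQCDFlow.Scaling.DominatedStarMinorization
import Summits.Ventures.LatticeQCDFlow.Scaling.RegenerationTagDecay

/-!
HONEST FRAMING: exact (Metropolis-corrected) sampling algorithms for lattice gauge theory; figures
of merit are autocorrelation/cost numbers at stated couplings and volumes; no continuum-physics
claim.

# DominatedStarMixingCeiling — THE COUPON-COLLECTOR CEILING WITHOUT PERFECT TRANSPORTS: FOR THE MAP-ASSISTED
# HOT-REFRESHED HUB (EXACT HOT SAMPLER, STATIONARY COLD UPDATES OF ANY WEIGHTS, HUB MULTIPLICITY `≥ c`) UNDER ONE-SIDED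
# DOMINATION `p·μ_l(φ_r u) ≤ μ_0(u)` AND `4t ≤ p(1−t)w_0`:  `d(n) ≤ ((2K+p)/p)·(1 − t·c·p/(2m))ⁿ`, SO
# `t_mix(ε) ≤ ⌈(2m/(tcp))·log((2K+p)/(pε))⌉` — ORDER `K·log K` AT `m = cK`; WITH PERFECT TRANSPORTS (ANY LAWS, ANY
# WEIGHTS) `d(n) ≤ 2(K+1)(1 − t(1−t)w_0c/(2m))ⁿ` WITH NO CONDITION ON `t` (lean-2 GEN-25, ours)

Venture-side (OURS).  Cell `lqcd-flow` (pub-lqcd), unit `pub-lqcd-lean-2-g25`, 2026-08-27.  Chapter M (the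
coupon-collector ceiling without perfect transports), file 9 — the statements for the scheme itself.  THE SCHEME
`P = t·GSw + (1−t)·Π_w^M` on `Fin (K+1) → S`: hub list `e_r = (0, κ_r+1)` of length `m` with bijections `φ_r`,
positive unit-mass laws `μ_k`, Metropolis graph swap `GSw` for `π̃ = ⊗μ_k`, update weights `w` (a probability vector,
`w_0 > 0`), the EXACT hot sampler `M_0(u,·) = μ_0` and `μ_k`-STATIONARY cold kernels `M_k` (`Σ_u μ_k(u)M_k(u,v) = μ_k(v)`;
e.g. any reversible local update, or the identity).  Chapter L proved the `K·log K` law from both sides for PERFECT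
transports with identity maps and hot-only updates; here the ceiling is proved (i) for IMPERFECT transports under the
one-sided domination of chapter J, at swap fractions `t ≤ p(1−t)w_0/4`, and (ii) for perfect transports
`μ_{l_r} ∘ φ_r = μ_0` with arbitrary laws, maps and update weights, with no condition on `t`.

## What is proved

* §1 **`dominatedStar_worstTvDist_le`** — `0 < p ≤ 1`, `0 ≤ q ≤ 1`, `p·μ_l(φ_r u) ≤ μ_0(u)`, `q·μ_0(u) ≤ μ_l(φ_r u)`,
  `4t ≤ p(1−t)w_0`, hub multiplicities `≥ c ≥ 1`: `d(n) ≤ ((2K+p)/p)·(1 − tcp/(2m))ⁿ`;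
  **`dominatedStar_worstTvDist_le_oneSided`** — the same with `q` dropped (ONE-SIDED DOMINATION SUFFICES);
  `dominatedStar_worstTvDist_le_of_ge_log`; **`dominatedStar_mixingTime_le`** —
  `t_mix(ε) ≤ ⌈(2m/(tcp))·log((2K+p)/(pε))⌉`.
* §2 **`perfectStar_worstTvDist_le`** — perfect transports `μ_{l_r}(φ_r u) = μ_0(u)`, `0 < t < 1`:
  `d(n) ≤ 2(K+1)·(1 − t(1−t)w_0c/(2m))ⁿ`; `perfectStar_worstTvDist_le_of_ge_log`; **`perfectStar_mixingTime_le`** —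
  `t_mix(ε) ≤ ⌈(2m/(t(1−t)w_0c))·log(2(K+1)/ε)⌉` (for `w_0 = 1`, identity maps and one law this is the ceiling of
  `Scaling/IdealStarMixingCeiling` up to the constant).

Reading (no numerics implied): a learned transport that dominates one-sidedly with constant `p` keeps the
coupon-collector mixing law of the hot-refreshed hub — `(2m/(tcp))·log((2K+p)/(pε))` steps, against the collector
floor `(K/θ − 1)·log(K/4)` of `Scaling/HubCollectorLaw` — provided the swap odds `t/((1−t)w_0)` stay below `p/4`; the
quality of the transport enters only through `p`, linearly in the time constant; cold updates are pure dilution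
(`w_0`).  NOT CLAIMED: optimality of the regime condition (an artefact of the conservative tags: a stale hub dirties
every partner), the matching floor for general maps (chapter L's floor is `(1/θ − 1)·log`, with `θ` the touch rate),
anything for inexact hot samplers or non-stationary cold updates, anything measured.  Literature grade (cell rule):
OWN RESULT; nothing cited as a fact; no new bib keys.
-/

noncomputable section

open Finset Function
open Literature.Probability.MarkovChains

namespace Summit.Ventures.LatticeQCDFlow.Scaling

variable {S : Type*} [Fintype S] [DecidableEq S] {K m : ℕ} {μ : Fin (K + 1) → S → ℝ} {M : Fin (K + 1) → S → S → ℝ}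
  {w : Fin (K + 1) → ℝ} {t p q : ℝ}

section Ceiling
variable (κ : Fin m → Fin K) (φ : Fin m → Equiv.Perm S)

/-! ## §1 One-sided domination -/

/-- **THE DISTANCE PROFILE UNDER THE TWO ONE-SIDED DOMINATIONS:** `0 < p ≤ 1`, `0 ≤ q ≤ 1`,
`p·μ_{l_r}(φ_r u) ≤ μ_0(u)`, `q·μ_0(u) ≤ μ_{l_r}(φ_r u)`, `4t ≤ p(1−t)w_0`, hub multiplicities `c ≤ #{r : κ_r = p'}`,
`1 ≤ c ≤ m`, exact hot sampler, stationary cold kernels: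
**`d(n) ≤ ((2K+p)/p)·(1 − t·c·p/(2m))ⁿ`.** [ours] -/
theorem dominatedStar_worstTvDist_le (hm : 1 ≤ m) (ht0 : 0 ≤ t) (ht1 : t ≤ 1) (hw0 : ∀ k, 0 ≤ w k)
    (hw1 : ∑ k, w k = 1) (hμ : ∀ k x, 0 < μ k x) (hμ1 : ∀ k, ∑ u, μ k u = 1) (hM : ∀ k, IsRowStochastic (M k))
    (hM0 : ∀ u v, M 0 u v = μ 0 v) (hstat : ∀ k : Fin (K + 1), k ≠ 0 → ∀ v, ∑ u, μ k u * M k u v = μ k v)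
    (hp0 : 0 < p) (hp1 : p ≤ 1) (hq0 : 0 ≤ q) (hq1 : q ≤ 1) (hdom : ∀ r u, p * μ (κ r).succ (φ r u) ≤ μ 0 u)
    (hrev : ∀ r u, q * μ 0 u ≤ μ (κ r).succ (φ r u)) (hreg : 4 * t ≤ p * (1 - t) * w 0)
    {c : ℕ} (hc1 : 1 ≤ c) (hc : ∀ p' : Fin K, c ≤ (univ.filter (fun r : Fin m => κ r = p')).card) (hcm : c ≤ m)
    (n : ℕ) :
    worstTvDist (fun y z : Fin (K + 1) → S =>
        t * ptGraphSwap μ (fun r : Fin m => (((0 : Fin (K + 1)), (κ r).succ) : Fin (K + 1) × Fin (K + 1))) φ y z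
          + (1 - t) * prodKernel w M y z) (tensorFun μ) n
      ≤ (2 * (K : ℝ) + p) / p * (1 - t * c * p / (2 * m)) ^ n := by
  -- the hypothesis-equation objects of the chapter
  set α : Fin m → (Fin (K + 1) → S) → ℝ :=
    fun r z => min 1 (tensorFun μ (edgeFlowSwap (φ r) 0 (κ r).succ z) / tensorFun μ z) with hα_def
  have hα : ∀ r z, α r z = min 1 (tensorFun μ (edgeFlowSwap (φ r) 0 (κ r).succ z) / tensorFun μ z) := fun _ _ => rfl
  set β : Fin m → (Fin (K + 1) → S) → ℝ := fun r z => p * μ (κ r).succ (φ r (z 0)) / μ 0 (z 0) with hβ_def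
  have hβ : ∀ r z, β r z = p * μ (κ r).succ (φ r (z 0)) / μ 0 (z 0) := fun _ _ => rfl
  set β' : Fin m → (Fin (K + 1) → S) → ℝ :=
    fun r z => q * μ 0 ((φ r).symm (z (κ r).succ)) / μ (κ r).succ (z (κ r).succ) with hβ'_def
  have hβ' : ∀ r z, β' r z = q * μ 0 ((φ r).symm (z (κ r).succ)) / μ (κ r).succ (z (κ r).succ) := fun _ _ => rfl
  set γ : Fin m → (Fin (K + 1) → S) × Finset (Fin (K + 1)) → ℝ := fun r a =>
    if (0 : Fin (K + 1)) ∉ a.2 then (if (κ r).succ ∉ a.2 then α r a.1 else β r a.1)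
      else (if (κ r).succ ∉ a.2 then β' r a.1 else 0) with hγ_def
  have hγ : ∀ r a, γ r a = if (0 : Fin (K + 1)) ∉ a.2 then (if (κ r).succ ∉ a.2 then α r a.1 else β r a.1)
      else (if (κ r).succ ∉ a.2 then β' r a.1 else 0) := fun _ _ => rfl
  set gbar : Fin m → Finset (Fin (K + 1)) → ℝ := fun r D =>
    if (0 : Fin (K + 1)) ∉ D then (if (κ r).succ ∉ D then (1 : ℝ) else p) else (if (κ r).succ ∉ D then q else 0)
    with hg_def
  have hg : ∀ r D, gbar r D = if (0 : Fin (K + 1)) ∉ D then (if (κ r).succ ∉ D then (1 : ℝ) else p)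
      else (if (κ r).succ ∉ D then q else 0) := fun _ _ => rfl
  set Bset : Fin m → Finset (Fin (K + 1)) → Finset (Fin (K + 1)) := fun r D =>
    if (0 : Fin (K + 1)) ∉ D ∧ (κ r).succ ∉ D then D else insert (0 : Fin (K + 1)) (insert (κ r).succ D) with hB_def
  have hB : ∀ r D, Bset r D = if (0 : Fin (K + 1)) ∉ D ∧ (κ r).succ ∉ D then D
      else insert (0 : Fin (K + 1)) (insert (κ r).succ D) := fun _ _ => rfl
  set Ph : (Fin (K + 1) → S) × Finset (Fin (K + 1)) → (Fin (K + 1) → S) × Finset (Fin (K + 1)) → ℝ := fun a b =>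
    ∑ r : Fin m, t / m *
        (γ r a * (if b.1 = edgeFlowSwap (φ r) 0 (κ r).succ a.1 ∧ b.2 = a.2.image (Equiv.swap (0 : Fin (K + 1)) (κ r).succ)
            then (1 : ℝ) else 0)
          + (α r a.1 - γ r a) * (if b.1 = edgeFlowSwap (φ r) 0 (κ r).succ a.1 ∧ b.2 = Bset r a.2 then (1 : ℝ) else 0)
          + (1 - α r a.1) * (if b.1 = a.1 ∧ b.2 = Bset r a.2 then (1 : ℝ) else 0))
      + (1 - t) * ∑ k : Fin (K + 1), w k * (coordKernel M k a.1 b.1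
          * (if b.2 = (if k = 0 then a.2.erase 0 else a.2) then (1 : ℝ) else 0)) with hPh_def
  have hPh : ∀ a b, Ph a b = ∑ r : Fin m, t / m *
        (γ r a * (if b.1 = edgeFlowSwap (φ r) 0 (κ r).succ a.1 ∧ b.2 = a.2.image (Equiv.swap (0 : Fin (K + 1)) (κ r).succ)
            then (1 : ℝ) else 0)
          + (α r a.1 - γ r a) * (if b.1 = edgeFlowSwap (φ r) 0 (κ r).succ a.1 ∧ b.2 = Bset r a.2 then (1 : ℝ) else 0)
          + (1 - α r a.1) * (if b.1 = a.1 ∧ b.2 = Bset r a.2 then (1 : ℝ) else 0))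
      + (1 - t) * ∑ k : Fin (K + 1), w k * (coordKernel M k a.1 b.1
          * (if b.2 = (if k = 0 then a.2.erase 0 else a.2) then (1 : ℝ) else 0)) := fun _ _ => rfl
  set Q : Finset (Fin (K + 1)) → Finset (Fin (K + 1)) → ℝ := fun D D' => ∑ r : Fin m, t / m *
        (gbar r D * (if D' = D.image (Equiv.swap (0 : Fin (K + 1)) (κ r).succ) then (1 : ℝ) else 0)
          + (1 - gbar r D) * (if D' = Bset r D then (1 : ℝ) else 0))
      + (1 - t) * (w 0 * (if D' = D.erase 0 then (1 : ℝ) else 0) + (1 - w 0) * (if D' = D then (1 : ℝ) else 0)) with hQ_def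
  have hQ : ∀ D D', Q D D' = ∑ r : Fin m, t / m *
        (gbar r D * (if D' = D.image (Equiv.swap (0 : Fin (K + 1)) (κ r).succ) then (1 : ℝ) else 0)
          + (1 - gbar r D) * (if D' = Bset r D then (1 : ℝ) else 0))
      + (1 - t) * (w 0 * (if D' = D.erase 0 then (1 : ℝ) else 0) + (1 - w 0) * (if D' = D then (1 : ℝ) else 0)) :=
    fun _ _ => rfl
  have hw00 : 0 ≤ w 0 := hw0 0
  have hw01 : w 0 ≤ 1 := by
    have h := Finset.single_le_sum (f := w) (fun k _ => hw0 k) (mem_univ (0 : Fin (K + 1)))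
    rw [hw1] at h; exact h
  have htag := regen_nonempty_le_oneSided κ hm ht0 ht1 hw00 hw01 hp0 hp1 hq0 hq1 hreg hg hB hQ hc1 hc hcm n
  have hbound : 0 ≤ (2 * (K : ℝ) + p) / p * (1 - t * c * p / (2 * m)) ^ n :=
    le_trans (sum_nonneg fun D _ => lawAt_nonneg (regen_isRowStochastic κ hm ht0 ht1 hw00 hw01 hp0.le hp1 hq0 hq1 hg hQ)
      (fun U => by
        by_cases h : U = univ
        · subst h; rw [Pi.single_eq_same]; norm_num
        · rw [Pi.single_eq_of_ne h]) n D) htag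
  refine Real.iSup_le (fun x => ?_) hbound
  exact (dom_tvDist_le_stale κ φ hm ht0 ht1 hw0 hw1 hμ hμ1 hM hM0 hstat hp0.le hp1 hq0 hq1 hdom hrev hα hβ hβ' hγ hg hB
    hPh hQ x n).trans htag

/-- **ONE-SIDED DOMINATION SUFFICES:** with only `p·μ_{l_r}(φ_r u) ≤ μ_0(u)` (`0 < p ≤ 1`) and `4t ≤ p(1−t)w_0`:
`d(n) ≤ ((2K+p)/p)·(1 − t·c·p/(2m))ⁿ`. [ours] -/
theorem dominatedStar_worstTvDist_le_oneSided (hm : 1 ≤ m) (ht0 : 0 ≤ t) (ht1 : t ≤ 1) (hw0 : ∀ k, 0 ≤ w k)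
    (hw1 : ∑ k, w k = 1) (hμ : ∀ k x, 0 < μ k x) (hμ1 : ∀ k, ∑ u, μ k u = 1) (hM : ∀ k, IsRowStochastic (M k))
    (hM0 : ∀ u v, M 0 u v = μ 0 v) (hstat : ∀ k : Fin (K + 1), k ≠ 0 → ∀ v, ∑ u, μ k u * M k u v = μ k v)
    (hp0 : 0 < p) (hp1 : p ≤ 1) (hdom : ∀ r u, p * μ (κ r).succ (φ r u) ≤ μ 0 u) (hreg : 4 * t ≤ p * (1 - t) * w 0)
    {c : ℕ} (hc1 : 1 ≤ c) (hc : ∀ p' : Fin K, c ≤ (univ.filter (fun r : Fin m => κ r = p')).card) (hcm : c ≤ m)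
    (n : ℕ) :
    worstTvDist (fun y z : Fin (K + 1) → S =>
        t * ptGraphSwap μ (fun r : Fin m => (((0 : Fin (K + 1)), (κ r).succ) : Fin (K + 1) × Fin (K + 1))) φ y z
          + (1 - t) * prodKernel w M y z) (tensorFun μ) n
      ≤ (2 * (K : ℝ) + p) / p * (1 - t * c * p / (2 * m)) ^ n :=
  dominatedStar_worstTvDist_le κ φ hm ht0 ht1 hw0 hw1 hμ hμ1 hM hM0 hstat hp0 hp1 le_rfl zero_le_one hdom
    (fun r u => by rw [zero_mul]; exact (hμ _ _).le) hreg hc1 hc hcm n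

/-- **`n ≥ (2m/(tcp))·log((2K+p)/(pε))` ⇒ `d(n) ≤ ε`** under one-sided domination (`0 < t`). [ours] -/
theorem dominatedStar_worstTvDist_le_of_ge_log (hm : 1 ≤ m) (ht0 : 0 < t) (ht1 : t ≤ 1) (hw0 : ∀ k, 0 ≤ w k)
    (hw1 : ∑ k, w k = 1) (hμ : ∀ k x, 0 < μ k x) (hμ1 : ∀ k, ∑ u, μ k u = 1) (hM : ∀ k, IsRowStochastic (M k))
    (hM0 : ∀ u v, M 0 u v = μ 0 v) (hstat : ∀ k : Fin (K + 1), k ≠ 0 → ∀ v, ∑ u, μ k u * M k u v = μ k v)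
    (hp0 : 0 < p) (hp1 : p ≤ 1) (hdom : ∀ r u, p * μ (κ r).succ (φ r u) ≤ μ 0 u) (hreg : 4 * t ≤ p * (1 - t) * w 0)
    {c : ℕ} (hc1 : 1 ≤ c) (hc : ∀ p' : Fin K, c ≤ (univ.filter (fun r : Fin m => κ r = p')).card) (hcm : c ≤ m)
    {ε : ℝ} (hε : 0 < ε) {n : ℕ} (hn : 2 * (m : ℝ) / (t * c * p) * Real.log ((2 * (K : ℝ) + p) / (p * ε)) ≤ n) :
    worstTvDist (fun y z : Fin (K + 1) → S =>
        t * ptGraphSwap μ (fun r : Fin m => (((0 : Fin (K + 1)), (κ r).succ) : Fin (K + 1) × Fin (K + 1))) φ y z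
          + (1 - t) * prodKernel w M y z) (tensorFun μ) n ≤ ε := by
  have hmpos : (0 : ℝ) < m := Nat.cast_pos.mpr (by omega)
  have hcpos : (0 : ℝ) < c := Nat.cast_pos.mpr (by omega)
  have hcm' : (c : ℝ) ≤ m := by exact_mod_cast hcm
  refine (dominatedStar_worstTvDist_le_oneSided κ φ hm ht0.le ht1 hw0 hw1 hμ hμ1 hM hM0 hstat hp0 hp1 hdom hreg hc1 hc
    hcm n).trans ?_
  have ha0 : 0 < t * c * p / (2 * m) := by positivity
  have ha1 : t * c * p / (2 * m) ≤ 1 := by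
    rw [div_le_one (by positivity)]
    have h1 : t * c ≤ 1 * m := by nlinarith
    nlinarith
  have hC : 0 < (2 * (K : ℝ) + p) / p := by positivity
  refine geom_le_of_ge_log ha0 ha1 hC hε ?_
  have e1 : 1 / (t * c * p / (2 * m)) = 2 * (m : ℝ) / (t * c * p) := by field_simp
  have e2 : (2 * (K : ℝ) + p) / p / ε = (2 * (K : ℝ) + p) / (p * ε) := by rw [div_div]
  rw [e1, e2]; exact hn

/-- **THE MIXING CEILING UNDER ONE-SIDED DOMINATION: `t_mix(ε) ≤ ⌈(2m/(tcp))·log((2K+p)/(pε))⌉`** (`0 < t`). [ours] -/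
theorem dominatedStar_mixingTime_le (hm : 1 ≤ m) (ht0 : 0 < t) (ht1 : t ≤ 1) (hw0 : ∀ k, 0 ≤ w k)
    (hw1 : ∑ k, w k = 1) (hμ : ∀ k x, 0 < μ k x) (hμ1 : ∀ k, ∑ u, μ k u = 1) (hM : ∀ k, IsRowStochastic (M k))
    (hM0 : ∀ u v, M 0 u v = μ 0 v) (hstat : ∀ k : Fin (K + 1), k ≠ 0 → ∀ v, ∑ u, μ k u * M k u v = μ k v)
    (hp0 : 0 < p) (hp1 : p ≤ 1) (hdom : ∀ r u, p * μ (κ r).succ (φ r u) ≤ μ 0 u) (hreg : 4 * t ≤ p * (1 - t) * w 0)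
    {c : ℕ} (hc1 : 1 ≤ c) (hc : ∀ p' : Fin K, c ≤ (univ.filter (fun r : Fin m => κ r = p')).card) (hcm : c ≤ m)
    {ε : ℝ} (hε : 0 < ε) :
    mixingTime (fun y z : Fin (K + 1) → S =>
        t * ptGraphSwap μ (fun r : Fin m => (((0 : Fin (K + 1)), (κ r).succ) : Fin (K + 1) × Fin (K + 1))) φ y z
          + (1 - t) * prodKernel w M y z) (tensorFun μ) ε
      ≤ ⌈2 * (m : ℝ) / (t * c * p) * Real.log ((2 * (K : ℝ) + p) / (p * ε))⌉₊ :=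
  mixingTime_le _ _ (dominatedStar_worstTvDist_le_of_ge_log κ φ hm ht0 ht1 hw0 hw1 hμ hμ1 hM hM0 hstat hp0 hp1 hdom hreg
    hc1 hc hcm hε (Nat.le_ceil _))

/-! ## §2 Perfect transports: arbitrary laws, maps and update weights, no condition on `t` -/

/-- **THE DISTANCE PROFILE WITH PERFECT TRANSPORTS:** `μ_{l_r}(φ_r u) = μ_0(u)` on every hub edge, `0 < t < 1`,
`w_0 > 0`, exact hot sampler, stationary cold kernels, hub multiplicities `≥ c ≥ 1`:
**`d(n) ≤ 2(K+1)·(1 − t(1−t)w_0c/(2m))ⁿ`.** [ours] -/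
theorem perfectStar_worstTvDist_le (hm : 1 ≤ m) (ht0 : 0 < t) (ht1 : t < 1) (hw0 : ∀ k, 0 ≤ w k) (hw00 : 0 < w 0)
    (hw1 : ∑ k, w k = 1) (hμ : ∀ k x, 0 < μ k x) (hμ1 : ∀ k, ∑ u, μ k u = 1) (hM : ∀ k, IsRowStochastic (M k))
    (hM0 : ∀ u v, M 0 u v = μ 0 v) (hstat : ∀ k : Fin (K + 1), k ≠ 0 → ∀ v, ∑ u, μ k u * M k u v = μ k v)
    (hperf : ∀ r u, μ (κ r).succ (φ r u) = μ 0 u)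
    {c : ℕ} (hc1 : 1 ≤ c) (hc : ∀ p' : Fin K, c ≤ (univ.filter (fun r : Fin m => κ r = p')).card) (hcm : c ≤ m)
    (n : ℕ) :
    worstTvDist (fun y z : Fin (K + 1) → S =>
        t * ptGraphSwap μ (fun r : Fin m => (((0 : Fin (K + 1)), (κ r).succ) : Fin (K + 1) × Fin (K + 1))) φ y z
          + (1 - t) * prodKernel w M y z) (tensorFun μ) n
      ≤ 2 * ((K : ℝ) + 1) * (1 - t * (1 - t) * w 0 * c / (2 * m)) ^ n := by
  set α : Fin m → (Fin (K + 1) → S) → ℝ :=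
    fun r z => min 1 (tensorFun μ (edgeFlowSwap (φ r) 0 (κ r).succ z) / tensorFun μ z) with hα_def
  have hα : ∀ r z, α r z = min 1 (tensorFun μ (edgeFlowSwap (φ r) 0 (κ r).succ z) / tensorFun μ z) := fun _ _ => rfl
  set β : Fin m → (Fin (K + 1) → S) → ℝ := fun r z => (1 : ℝ) * μ (κ r).succ (φ r (z 0)) / μ 0 (z 0) with hβ_def
  have hβ : ∀ r z, β r z = (1 : ℝ) * μ (κ r).succ (φ r (z 0)) / μ 0 (z 0) := fun _ _ => rfl
  set β' : Fin m → (Fin (K + 1) → S) → ℝ :=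
    fun r z => (1 : ℝ) * μ 0 ((φ r).symm (z (κ r).succ)) / μ (κ r).succ (z (κ r).succ) with hβ'_def
  have hβ' : ∀ r z, β' r z = (1 : ℝ) * μ 0 ((φ r).symm (z (κ r).succ)) / μ (κ r).succ (z (κ r).succ) :=
    fun _ _ => rfl
  set γ : Fin m → (Fin (K + 1) → S) × Finset (Fin (K + 1)) → ℝ := fun r a =>
    if (0 : Fin (K + 1)) ∉ a.2 then (if (κ r).succ ∉ a.2 then α r a.1 else β r a.1)
      else (if (κ r).succ ∉ a.2 then β' r a.1 else 0) with hγ_def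
  have hγ : ∀ r a, γ r a = if (0 : Fin (K + 1)) ∉ a.2 then (if (κ r).succ ∉ a.2 then α r a.1 else β r a.1)
      else (if (κ r).succ ∉ a.2 then β' r a.1 else 0) := fun _ _ => rfl
  set gbar : Fin m → Finset (Fin (K + 1)) → ℝ := fun r D =>
    if (0 : Fin (K + 1)) ∉ D then (if (κ r).succ ∉ D then (1 : ℝ) else (1 : ℝ))
      else (if (κ r).succ ∉ D then (1 : ℝ) else 0) with hg_def
  have hg : ∀ r D, gbar r D = if (0 : Fin (K + 1)) ∉ D then (if (κ r).succ ∉ D then (1 : ℝ) else (1 : ℝ))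
      else (if (κ r).succ ∉ D then (1 : ℝ) else 0) := fun _ _ => rfl
  set Bset : Fin m → Finset (Fin (K + 1)) → Finset (Fin (K + 1)) := fun r D =>
    if (0 : Fin (K + 1)) ∉ D ∧ (κ r).succ ∉ D then D else insert (0 : Fin (K + 1)) (insert (κ r).succ D) with hB_def
  have hB : ∀ r D, Bset r D = if (0 : Fin (K + 1)) ∉ D ∧ (κ r).succ ∉ D then D
      else insert (0 : Fin (K + 1)) (insert (κ r).succ D) := fun _ _ => rfl
  set Ph : (Fin (K + 1) → S) × Finset (Fin (K + 1)) → (Fin (K + 1) → S) × Finset (Fin (K + 1)) → ℝ := fun a b =>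
    ∑ r : Fin m, t / m *
        (γ r a * (if b.1 = edgeFlowSwap (φ r) 0 (κ r).succ a.1 ∧ b.2 = a.2.image (Equiv.swap (0 : Fin (K + 1)) (κ r).succ)
            then (1 : ℝ) else 0)
          + (α r a.1 - γ r a) * (if b.1 = edgeFlowSwap (φ r) 0 (κ r).succ a.1 ∧ b.2 = Bset r a.2 then (1 : ℝ) else 0)
          + (1 - α r a.1) * (if b.1 = a.1 ∧ b.2 = Bset r a.2 then (1 : ℝ) else 0))
      + (1 - t) * ∑ k : Fin (K + 1), w k * (coordKernel M k a.1 b.1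
          * (if b.2 = (if k = 0 then a.2.erase 0 else a.2) then (1 : ℝ) else 0)) with hPh_def
  have hPh : ∀ a b, Ph a b = ∑ r : Fin m, t / m *
        (γ r a * (if b.1 = edgeFlowSwap (φ r) 0 (κ r).succ a.1 ∧ b.2 = a.2.image (Equiv.swap (0 : Fin (K + 1)) (κ r).succ)
            then (1 : ℝ) else 0)
          + (α r a.1 - γ r a) * (if b.1 = edgeFlowSwap (φ r) 0 (κ r).succ a.1 ∧ b.2 = Bset r a.2 then (1 : ℝ) else 0)
          + (1 - α r a.1) * (if b.1 = a.1 ∧ b.2 = Bset r a.2 then (1 : ℝ) else 0))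
      + (1 - t) * ∑ k : Fin (K + 1), w k * (coordKernel M k a.1 b.1
          * (if b.2 = (if k = 0 then a.2.erase 0 else a.2) then (1 : ℝ) else 0)) := fun _ _ => rfl
  set Q : Finset (Fin (K + 1)) → Finset (Fin (K + 1)) → ℝ := fun D D' => ∑ r : Fin m, t / m *
        (gbar r D * (if D' = D.image (Equiv.swap (0 : Fin (K + 1)) (κ r).succ) then (1 : ℝ) else 0)
          + (1 - gbar r D) * (if D' = Bset r D then (1 : ℝ) else 0))
      + (1 - t) * (w 0 * (if D' = D.erase 0 then (1 : ℝ) else 0) + (1 - w 0) * (if D' = D then (1 : ℝ) else 0)) with hQ_def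
  have hQ : ∀ D D', Q D D' = ∑ r : Fin m, t / m *
        (gbar r D * (if D' = D.image (Equiv.swap (0 : Fin (K + 1)) (κ r).succ) then (1 : ℝ) else 0)
          + (1 - gbar r D) * (if D' = Bset r D then (1 : ℝ) else 0))
      + (1 - t) * (w 0 * (if D' = D.erase 0 then (1 : ℝ) else 0) + (1 - w 0) * (if D' = D then (1 : ℝ) else 0)) :=
    fun _ _ => rfl
  have hw01 : w 0 ≤ 1 := by
    have h := Finset.single_le_sum (f := w) (fun k _ => hw0 k) (mem_univ (0 : Fin (K + 1)))
    rw [hw1] at h; exact h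
  have hdom : ∀ r u, (1 : ℝ) * μ (κ r).succ (φ r u) ≤ μ 0 u := fun r u => by rw [one_mul, hperf]
  have hrev : ∀ r u, (1 : ℝ) * μ 0 u ≤ μ (κ r).succ (φ r u) := fun r u => by rw [one_mul, hperf]
  have htag := regen_nonempty_le_perfect κ hm ht0 ht1 hw00 hw01 rfl rfl hg hB hQ hc1 hc hcm n
  have hbound : 0 ≤ 2 * ((K : ℝ) + 1) * (1 - t * (1 - t) * w 0 * c / (2 * m)) ^ n :=
    le_trans (sum_nonneg fun D _ => lawAt_nonneg (regen_isRowStochastic κ hm ht0.le ht1.le hw00.le hw01 zero_le_one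
      le_rfl zero_le_one le_rfl hg hQ) (fun U => by
        by_cases h : U = univ
        · subst h; rw [Pi.single_eq_same]; norm_num
        · rw [Pi.single_eq_of_ne h]) n D) htag
  refine Real.iSup_le (fun x => ?_) hbound
  exact (dom_tvDist_le_stale κ φ hm ht0.le ht1.le hw0 hw1 hμ hμ1 hM hM0 hstat zero_le_one le_rfl zero_le_one le_rfl
    hdom hrev hα hβ hβ' hγ hg hB hPh hQ x n).trans htag

/-- **`n ≥ (2m/(t(1−t)w_0c))·log(2(K+1)/ε)` ⇒ `d(n) ≤ ε`** with perfect transports. [ours] -/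
theorem perfectStar_worstTvDist_le_of_ge_log (hm : 1 ≤ m) (ht0 : 0 < t) (ht1 : t < 1) (hw0 : ∀ k, 0 ≤ w k)
    (hw00 : 0 < w 0) (hw1 : ∑ k, w k = 1) (hμ : ∀ k x, 0 < μ k x) (hμ1 : ∀ k, ∑ u, μ k u = 1)
    (hM : ∀ k, IsRowStochastic (M k)) (hM0 : ∀ u v, M 0 u v = μ 0 v)
    (hstat : ∀ k : Fin (K + 1), k ≠ 0 → ∀ v, ∑ u, μ k u * M k u v = μ k v) (hperf : ∀ r u, μ (κ r).succ (φ r u) = μ 0 u)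
    {c : ℕ} (hc1 : 1 ≤ c) (hc : ∀ p' : Fin K, c ≤ (univ.filter (fun r : Fin m => κ r = p')).card) (hcm : c ≤ m)
    {ε : ℝ} (hε : 0 < ε) {n : ℕ} (hn : 2 * (m : ℝ) / (t * (1 - t) * w 0 * c) * Real.log (2 * ((K : ℝ) + 1) / ε) ≤ n) :
    worstTvDist (fun y z : Fin (K + 1) → S =>
        t * ptGraphSwap μ (fun r : Fin m => (((0 : Fin (K + 1)), (κ r).succ) : Fin (K + 1) × Fin (K + 1))) φ y z
          + (1 - t) * prodKernel w M y z) (tensorFun μ) n ≤ ε := by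
  have hmpos : (0 : ℝ) < m := Nat.cast_pos.mpr (by omega)
  have hcpos : (0 : ℝ) < c := Nat.cast_pos.mpr (by omega)
  have hcm' : (c : ℝ) ≤ m := by exact_mod_cast hcm
  have h1t : 0 < 1 - t := by linarith
  have hw01 : w 0 ≤ 1 := by
    have h := Finset.single_le_sum (f := w) (fun k _ => hw0 k) (mem_univ (0 : Fin (K + 1)))
    rw [hw1] at h; exact h
  refine (perfectStar_worstTvDist_le κ φ hm ht0 ht1 hw0 hw00 hw1 hμ hμ1 hM hM0 hstat hperf hc1 hc hcm n).trans ?_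
  have ha0 : 0 < t * (1 - t) * w 0 * c / (2 * m) := by positivity
  have ha1 : t * (1 - t) * w 0 * c / (2 * m) ≤ 1 := by
    rw [div_le_one (by positivity)]
    have h1 : t * (1 - t) ≤ 1 := by nlinarith
    have h2 : t * (1 - t) * w 0 ≤ 1 := by nlinarith
    nlinarith
  have hC : 0 < 2 * ((K : ℝ) + 1) := by positivity
  refine geom_le_of_ge_log ha0 ha1 hC hε ?_
  have e1 : 1 / (t * (1 - t) * w 0 * c / (2 * m)) = 2 * (m : ℝ) / (t * (1 - t) * w 0 * c) := by field_simp
  rw [e1]; exact hn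

/-- **THE MIXING CEILING WITH PERFECT TRANSPORTS: `t_mix(ε) ≤ ⌈(2m/(t(1−t)w_0c))·log(2(K+1)/ε)⌉`.** [ours] -/
theorem perfectStar_mixingTime_le (hm : 1 ≤ m) (ht0 : 0 < t) (ht1 : t < 1) (hw0 : ∀ k, 0 ≤ w k) (hw00 : 0 < w 0)
    (hw1 : ∑ k, w k = 1) (hμ : ∀ k x, 0 < μ k x) (hμ1 : ∀ k, ∑ u, μ k u = 1) (hM : ∀ k, IsRowStochastic (M k))
    (hM0 : ∀ u v, M 0 u v = μ 0 v) (hstat : ∀ k : Fin (K + 1), k ≠ 0 → ∀ v, ∑ u, μ k u * M k u v = μ k v)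
    (hperf : ∀ r u, μ (κ r).succ (φ r u) = μ 0 u)
    {c : ℕ} (hc1 : 1 ≤ c) (hc : ∀ p' : Fin K, c ≤ (univ.filter (fun r : Fin m => κ r = p')).card) (hcm : c ≤ m)
    {ε : ℝ} (hε : 0 < ε) :
    mixingTime (fun y z : Fin (K + 1) → S =>
        t * ptGraphSwap μ (fun r : Fin m => (((0 : Fin (K + 1)), (κ r).succ) : Fin (K + 1) × Fin (K + 1))) φ y z
          + (1 - t) * prodKernel w M y z) (tensorFun μ) ε
      ≤ ⌈2 * (m : ℝ) / (t * (1 - t) * w 0 * c) * Real.log (2 * ((K : ℝ) + 1) / ε)⌉₊ :=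
  mixingTime_le _ _ (perfectStar_worstTvDist_le_of_ge_log κ φ hm ht0 ht1 hw0 hw00 hw1 hμ hμ1 hM hM0 hstat hperf hc1 hc
    hcm hε (Nat.le_ceil _))

end Ceiling

end Summit.Ventures.LatticeQCDFlow.Scaling

end
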